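import Literature.NumberTheory.Automorphic.GLnMaximalParabolicLocalModulus
import HarnessLib

/-!
# `δ_{P_c}^{1∕2}(p) = ‖det K_p‖_F^{1∕2}`: the normalising character of a two-block standard parabolic of `GL_n(F)` against the box matrix of `Ad(p)` on
# its unipotent radical (Bernstein–Zelevinsky 1977, 1.7; Rogawski 1990, §4.13 Lemma 4.13.1)

Topic `NumberTheory/Automorphic`; namespace `Literature.NumberTheory.Automorphic`.  THEOREMS ONLY (no definition, no named fact, no instance, no notation, no
`sorry`).  Cell `pub/hodgecm-mathlib`, companion of the typer file `UnitaryGroupConstantTermSplit` (D1 of the F0P3b desk): the tree carries the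
modulus of `P_c = M_c U_c ≤ GL_n(F)` in TWO currencies — ★ `rootDeltaChar (standardParabolicGL F c)` (Mathlib's `modularCharacter`, the twist inside ★
`Representation.parabolicIndGL`, computed by ★ `rootDeltaChar_standardParabolicGL_bool` as `(‖det A‖^{n_true} ‖det B‖^{−n_false})^{1∕2}`) and the weight
`‖det K_p‖` of the parabolic descent files (★ `GLnLeviOrbitalDescent*`, ★ `Rogawski1990.SmoothTransferSplitPlace` §4: `K_p = (p_{ii′} (p⁻¹)_{j′j})`, the
matrix of `Ad(p)` on `𝔲_c ≅ F^{I × J}`).  They agree: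
* `normAbs_det_boxAd_eq` — `‖det K_p‖ = ‖det A‖^{n_true} · ‖det B‖^{−n_false}` (`K_p = A ⊗ ᵗ(B⁻¹)`, as in the `P ∩ K` case ★
  `normAbs_det_boxAd_eq_one_of_mem_glInt`);
* **`rootDeltaChar_standardParabolicGL_eq_sqrt_normAbs_det_boxAd`** — `δ_{P_c}^{1∕2}(p) = ‖det K_p‖^{1∕2}` (as complex numbers).
HONEST LABEL: HC_CM is proved only modulo the printed citations (2 remaining named inputs hLiu418, h413) until rung 0 closes; this file is `GL_n`
bookkeeping and discharges none of them.

## References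
* [BernsteinZelevinsky1977] I. N. Bernstein, A. V. Zelevinsky, *Induced representations of reductive 𝔭-adic groups I*, Ann. Sci. ÉNS 10 (1977), 1.7, §2.3.
* [Rogawski1990] J. D. Rogawski, *Automorphic Representations of Unitary Groups in Three Variables*, Ann. of Math. Stud. 123 (1990), §4.13 Lemma 4.13.1 pp. 64–66.
-/

set_option autoImplicit false

noncomputable section

open scoped Matrix MatrixGroups NNReal

namespace Literature.NumberTheory.Automorphic

section BoxDelta

open Literature.NumberTheory.GaloisRepresentations.IsNonarchimedeanLocalField

variable (F : Type*) [Field F] [ValuativeRel F] [TopologicalSpace F] [IsNonarchimedeanLocalField F] {n : ℕ} (c : Fin n → Bool)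

/-- **`‖det K_p‖ = ‖det A‖^{n_true} · ‖det B‖^{−n_false}`** for `p ∈ P_c` with Levi blocks `A = proj(p)_false`, `B = proj(p)_true`: the box matrix
`K_p = (p_{ii′} (p⁻¹)_{j′j})` of `Ad(p)` on `𝔲_c ≅ F^{I × J}` (the matrix of ★ `GLnLeviOrbitalDescent` ∕ ★ `Rogawski1990.SmoothTransferSplitPlace` §4) is the
Kronecker product of `A` with `ᵗ(B⁻¹)` (as in ★ `normAbs_det_boxAd_eq_one_of_mem_glInt`, whose `P ∩ K` case this generalises).
[cite: BernsteinZelevinsky1977, 1.7] -/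
theorem normAbs_det_boxAd_eq (p : standardParabolicGL F c) :
    normAbs F (Matrix.of fun q q' : {i : Fin n // c i = false} × {j : Fin n // c j = true} =>
        ((p : GL (Fin n) F) : Matrix (Fin n) (Fin n) F) q.1 q'.1 *
          (((p⁻¹ : standardParabolicGL F c) : GL (Fin n) F) : Matrix (Fin n) (Fin n) F) q'.2 q.2).det =
      normAbs F (Matrix.GeneralLinearGroup.det (leviProjection F c p false) : F) ^ Fintype.card {i : Fin n // c i = true} *
        (normAbs F (Matrix.GeneralLinearGroup.det (leviProjection F c p true) : F) ^ Fintype.card {i : Fin n // c i = false})⁻¹ := by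
  have hbox : (Matrix.of fun q q' : {i : Fin n // c i = false} × {j : Fin n // c j = true} =>
        ((p : GL (Fin n) F) : Matrix (Fin n) (Fin n) F) q.1 q'.1 *
          (((p⁻¹ : standardParabolicGL F c) : GL (Fin n) F) : Matrix (Fin n) (Fin n) F) q'.2 q.2) =
      Matrix.kroneckerMap (· * ·)
        ((leviProjection F c p false : GL {i : Fin n // c i = false} F) : Matrix {i : Fin n // c i = false} {i : Fin n // c i = false} F)
        ((leviProjection F c p⁻¹ true : GL {j : Fin n // c j = true} F) : Matrix {j : Fin n // c j = true} {j : Fin n // c j = true} F)ᵀ := by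
    ext q q'
    rw [Matrix.of_apply, Matrix.kroneckerMap_apply, Matrix.transpose_apply, leviProjection_apply_coe, leviProjection_apply_coe]
  have hinv : normAbs F ((leviProjection F c p⁻¹ true : GL {j : Fin n // c j = true} F) : Matrix {j : Fin n // c j = true} {j : Fin n // c j = true} F).det =
      (normAbs F (Matrix.GeneralLinearGroup.det (leviProjection F c p true) : F))⁻¹ := by
    rw [map_inv, Pi.inv_apply, ← Matrix.GeneralLinearGroup.val_det_apply, map_inv, Units.val_inv_eq_inv_val, map_inv₀]
  rw [hbox, Matrix.det_kronecker, Matrix.det_transpose, map_mul, map_pow, map_pow, hinv, inv_pow,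
    ← Matrix.GeneralLinearGroup.val_det_apply]

/-- **`δ_{P_c}^{1∕2}(p) = ‖det K_p‖^{1∕2}`**: the tree's normalising character ★ `rootDeltaChar` of the standard parabolic (the twist inside ★
`Representation.parabolicIndGL`) equals the square root of the box determinant of `Ad(p)` on `𝔲_c` (the weight of ★ `GLnLeviOrbitalDescent` ∕ ★
`Rogawski1990.SmoothTransferSplitPlace` §4) — the bridge between van Dijk's side and the orbital side of Lemma 4.13.1.
[cite: BernsteinZelevinsky1977, 1.7 and §2.3] [cite: Rogawski1990, §4.13 Lemma 4.13.1 pp. 64–66] -/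
theorem rootDeltaChar_standardParabolicGL_eq_sqrt_normAbs_det_boxAd (p : standardParabolicGL F c) :
    ((rootDeltaChar (standardParabolicGL F c) p : ℂˣ) : ℂ) =
      ((Real.sqrt ((normAbs F (Matrix.of fun q q' : {i : Fin n // c i = false} × {j : Fin n // c j = true} =>
          ((p : GL (Fin n) F) : Matrix (Fin n) (Fin n) F) q.1 q'.1 *
            (((p⁻¹ : standardParabolicGL F c) : GL (Fin n) F) : Matrix (Fin n) (Fin n) F) q'.2 q.2).det : ℝ≥0) : ℝ) : ℝ) : ℂ) := by
  rw [rootDeltaChar_standardParabolicGL_bool, normAbs_det_boxAd_eq, Real.coe_sqrt]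

end BoxDelta

end Literature.NumberTheory.Automorphic

end
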